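import Summits.Parity.GeneralizedHardyLittlewood.Theses.LeeYangFibres
import Literature.NumberTheory.Sieve.LinearEquationsInPrimesSingularSeries
import HarnessLib

/-!
# Route `LeeYangFibres`, crux `RelativeDimOne` (stmt-Parity-14113): vocabulary of the line
# `single-moebius-split` (one Möbius factor per term, every form opened at a staggered tiny level)

Route-posited objects (D-0016 `<Route><Crux>Defs` file) shared by the registered stubs of the checked
skeleton `Cruxes/RelativeDimOne/Lines/single_moebius_split.lean` (crux-strategist pass p1, reshaped by the
line lead `prover-line-stmt-Parity-14113-c7-0`) and by the crux file that composes them. NOTHING IS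
ASSERTED: every `def … : Prop` below is a *statement* — the type (or a component of the type) of a
registered stub (`stub_truncLatticeCount : ∀ k, TruncLatticeCount (k+1)`, `stub_truncSingularSeries :
∀ k, TruncSingularSeriesAsymp (k+1)`, `stub_moebiusTermBV : ∀ k, MoebiusTermBound k`, `stub_termBound :
∀ k j, j ≠ 0 → ∀ η > 0, (∀ C A, HybridOneMoebius j η C A) → TermBound k j η`, `stub_assembly`,
`stub_hybrid : ∀ s ≥ 1, ∃ η > 0, ∀ C A, HybridOneMoebius s η C A`). The only theorems here are sanity
lemmas about the vocabulary (`lambdaR_nonpos`, `mass_nonneg`, `slice_of_relativeDimOne`,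
`staggeredBy_mono`, `hybridOneMoebius_mono`), all proved.

THE LINE. For a non-degenerate `d = 1` system `Ψ = (ψ₀, …, ψ_k)` (`t = k + 1` forms, `‖Ψ‖_N ≤ L`)
write each factor as `Λ = Λ_R + (Λ − Λ_R)` with the Goldston–Yıldırım truncated divisor sum
`Λ_R(m) = ∑_{d ∣ m, d ≤ R} μ(d) log(R/d)` (`lambdaR`; `0` for `m ≤ 0`) at levels `R_i = N^{δ_i}`, the
exponents staggered (`StaggeredBy c δ`: `c ∑_{j > i} δ_j ≤ δ_i`) and of total `∑ δ_i ≤ 1/4`, and telescope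
`∏_i Λ(ψ_i) = ∏_i Λ_{R_i}(ψ_i) + ∑_j [∏_{i<j} Λ(ψ_i)] (Λ − Λ_{R_j})(ψ_j) [∏_{i>j} Λ_{R_i}(ψ_i)]`
(`truncCorrSum` + `∑_j telescopeTermSum … j`; term `j = 0` is `moebiusTermSum`).
* T1a `TruncLatticeCount`: the all-truncated sum equals `β_∞ · 𝔖_R(Ψ)` up to `εN`, where
  `𝔖_R(Ψ) = ∑_{d_i ≤ R_i} ∏_i μ(d_i) log(R_i/d_i) · ρ_Ψ(d)/∏ d_i` (`truncSingularSeries`, `solCount`) —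
  Chinese remainder / volume packing, lattice error `≪ N^{1/4+o(1)}`;
* T1b `TruncSingularSeriesAsymp`: `𝔖_R(Ψ) = 𝔖(Ψ) + o(𝔖(Ψ) + 1)` uniformly (multivariate
  Goldston–Yıldırım, Lemma 2.1 of GY-I iterated along staggered levels);
* T1 `TruncatedMainTerm` = T1a + T1b (`β_∞ ≤ 2N`);
* T0' `MoebiusTermBound`: term `0` is `o(N)` (Bombieri–Vinogradov for `μ`, level `1/2`, under
  `2∑_{i≥1}δ_i < δ_0`);
* S1 `TermBound k j η`: term `j ≥ 1` is `o(N)` GIVEN the atom `HybridOneMoebius j η C A` for all `C, A`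
  and the staggering `StaggeredBy (2 + 1/η) δ`;
* S2 (assembly): telescoping + T1 + T0' + S1 for `1 ≤ j ≤ k` ⟹ the crux's `(k+1)`-slice `RelDimOneSlice`;
* H `HybridOneMoebius` (THE ATOM, open): one Möbius factor along a form dilated by `≤ L Y^η` against
  `s` von Mangoldt factors along forms dilated by `≤ L Y^C`, log-power saving.

References: D. A. Goldston, C. Y. Yıldırım, Integers 3 (2003) A5 = arXiv:math/0111212, Lemma 2.1 and
Thm 1.1 [GoldstonYildirim2001]; B. Green, T. Tao, Ann. of Math. 171 (2010), Conj. 1.4, App. D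
[GreenTao2010]; W. Sawin, M. Shusterman, arXiv:1808.04001, Cor. 6.1, Thm 6.3 [SawinShusterman2018];
J. Lichtman, J. Teräväinen, arXiv:2211.xxxxx Conj. 1.1 / T. Tao, J. Teräväinen, Conj. 1.3 (hybrid
Hardy–Littlewood–Chowla) [LichtmanTeravainen2022, TaoTeravainen2021].
-/

noncomputable section

open scoped BigOperators Classical
open Filter Finset Literature.NumberTheory.Sieve
open Summit.Parity.GeneralizedHardyLittlewood.Theses.LeeYangFibres (RelativeDimOne)

namespace Summit.Parity.GeneralizedHardyLittlewood.Cruxes.RelativeDimOne.SingleMoebiusSplit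

/-! ## Vocabulary -/

/-- The Goldston–Yıldırım truncated divisor sum `Λ_R(m) = ∑_{d ∣ m, d ≤ R} μ(d) log(R/d)` for
`m ≥ 1`, and `0` for `m ≤ 0` (`Int.toNat` of a non-positive integer is `0` and `Nat.divisors 0 = ∅`),
so that, like `intVonMangoldt`, it vanishes off the positivity region of the forms. For `R ≥ m ≥ 2`,
`Λ_R(m) = Λ(m)`; on `[1, R]` in general `Λ_R = Λ + log R · [m = 1]`. -/
def lambdaR (R : ℝ) (m : ℤ) : ℝ :=
  ∑ d ∈ (Nat.divisors m.toNat).filter (fun d : ℕ => (d : ℝ) ≤ R),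
    ((ArithmeticFunction.moebius d : ℤ) : ℝ) * Real.log (R / (d : ℝ))

/-- The all-truncated correlation sum `∑_{n ∈ K ∩ ℤ} ∏_i Λ_{R_i}(ψ_i(n))` along a `d = 1` system. -/
def truncCorrSum {t : ℕ} (Ψ : Fin t → AffLinForm 1) (K : Set (Fin 1 → ℝ)) (N : ℕ)
    (R : Fin t → ℝ) : ℝ :=
  ∑ n ∈ (latticeBox 1 N).filter (fun n => realPoint n ∈ K), ∏ i, lambdaR (R i) ((Ψ i).eval n)

/-- Term `0` of the telescoping: form `0` carries `Λ − Λ_{R_0}` (its Möbius variable lives above `R_0`),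
the forms `i ≥ 1` carry `Λ_{R_i}`. -/
def moebiusTermSum {k : ℕ} (Ψ : Fin (k + 1) → AffLinForm 1) (K : Set (Fin 1 → ℝ)) (N : ℕ)
    (R : Fin (k + 1) → ℝ) : ℝ :=
  ∑ n ∈ (latticeBox 1 N).filter (fun n => realPoint n ∈ K),
    (intVonMangoldt ((Ψ 0).eval n) - lambdaR (R 0) ((Ψ 0).eval n)) *
      ∏ i : Fin k, lambdaR (R i.succ) ((Ψ i.succ).eval n)

/-- Term `j` of the telescoping `∏_i Λ(ψ_i) − ∏_i Λ_{R_i}(ψ_i) = ∑_j [∏_{i<j} Λ(ψ_i)] (Λ − Λ_{R_j})(ψ_j)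
[∏_{i>j} Λ_{R_i}(ψ_i)]`, summed over `n ∈ K ∩ ℤ`: the forms before `j` carry `Λ`, form `j` carries
`Λ − Λ_{R_j}` (one Möbius variable above `R_j`), the forms after `j` carry `Λ_{R_i}`. Term `0` is
`moebiusTermSum` (same value, `Fin.prod_univ_succ`). -/
def telescopeTermSum {k : ℕ} (Ψ : Fin (k + 1) → AffLinForm 1) (K : Set (Fin 1 → ℝ)) (N : ℕ)
    (R : Fin (k + 1) → ℝ) (j : Fin (k + 1)) : ℝ :=
  ∑ n ∈ (latticeBox 1 N).filter (fun n => realPoint n ∈ K),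
    (∏ i ∈ Finset.Iio j, intVonMangoldt ((Ψ i).eval n)) *
      (intVonMangoldt ((Ψ j).eval n) - lambdaR (R j) ((Ψ j).eval n)) *
        ∏ i ∈ Finset.Ioi j, lambdaR (R i) ((Ψ i).eval n)

/-- The Chinese-remainder count `ρ_Ψ(d) = #{n mod ∏_i d_i : d_i ∣ ψ_i(n) for all i}` of the divisibility
system attached to a tuple of moduli (so that `ρ_Ψ(d)/∏ d_i` is the density of
`{n ∈ ℤ : d_i ∣ ψ_i(n) ∀ i}`, a `∏ d_i`-periodic set). -/
def solCount {t : ℕ} (Ψ : Fin t → AffLinForm 1) (d : Fin t → ℕ) : ℕ :=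
  ((Finset.range (∏ i, d i)).filter
    (fun n : ℕ => ∀ i, ((d i : ℕ) : ℤ) ∣ (Ψ i).eval (fun _ => (n : ℤ)))).card

/-- The truncated singular series `𝔖_R(Ψ) = ∑_{1 ≤ d_i ≤ R_i} (∏_i μ(d_i) log(R_i/d_i)) ρ_Ψ(d)/∏_i d_i`
— the main-term coefficient of the all-truncated correlation sum (`μ` kills the non-square-free tuples). -/
def truncSingularSeries {t : ℕ} (Ψ : Fin t → AffLinForm 1) (R : Fin t → ℝ) : ℝ :=
  ∑ d ∈ Fintype.piFinset (fun i => Finset.Icc 1 ⌊R i⌋₊),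
    (∏ i, ((ArithmeticFunction.moebius (d i) : ℤ) : ℝ) * Real.log (R i / (d i : ℝ))) *
      (solCount Ψ d : ℝ) / (∏ i, (d i : ℝ))

/-- Staggered level exponents with ratio `c`: `c · ∑_{j > i} δ_j ≤ δ_i` for every index `i` (each level
dominates `c` times the sum of all LATER ones; geometric exponents `δ_i = δ₀ ρ^{-i}` are
`StaggeredBy (ρ − 1)`). -/
def StaggeredBy {t : ℕ} (c : ℝ) (δ : Fin t → ℝ) : Prop :=
  ∀ i : Fin t, c * (∑ j ∈ Finset.Ioi i, δ j) ≤ δ i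

/-- **The crux's `t`-slice**, verbatim (`RelativeDimOne = ∀ t ≥ 1, RelDimOneSlice t` up to the order of
the first binders; `slice_of_relativeDimOne`). -/
def RelDimOneSlice (t : ℕ) : Prop :=
  ∀ L : ℕ, ∀ ε : ℝ, 0 < ε → ∃ N₀ : ℕ, ∀ N : ℕ, N₀ ≤ N → ∀ Ψ : Fin t → AffLinForm 1,
    IsNondegenerateSystem Ψ → affLinSize Ψ N ≤ L →
    ∀ K : Set (Fin 1 → ℝ), Convex ℝ K → K ⊆ realBox 1 N →
      |vonMangoldtSum Ψ K N - archFactor Ψ K * singularProduct Ψ| ≤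
        ε * (archFactor Ψ K * singularProduct Ψ + N)

/-- **T1a — lattice count / volume packing for the all-truncated sum.** For levels `R_i = N^{δ_i}`,
`δ_i > 0`, `∑ δ_i ≤ 1/4`: uniformly over non-degenerate `d = 1` systems with `‖Ψ‖_N ≤ L` and convex
`K ⊆ [-N, N]`, `|∑_{n ∈ K∩ℤ} ∏_i Λ_{R_i}(ψ_i(n)) − β_∞(Ψ, K) · 𝔖_R(Ψ)| ≤ ε N` for `N ≥ N₀(t, L, δ, ε)`.
Content: `Λ_R` vanishes on non-positive arguments, so only `n ∈ K⁺ = K ∩ {ψ_i > 0 ∀ i}` (an interval of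
length `β_∞ = archFactor Ψ K`) contribute; expand the product over tuples `d_i ≤ R_i` and count
`#{n ∈ K⁺ ∩ ℤ : d_i ∣ ψ_i(n) ∀ i} = β_∞ ρ_Ψ(d)/∏ d_i + O(ρ_Ψ(d))`, `ρ_Ψ(d) ≤ L^t` for square-free tuples of a
non-degenerate system of size `≤ L`; total error `≪_t L^t ∏_i (R_i log R_i) ≤ N^{1/4 + o(1)}`.
Parity-blind, no primes, no distribution input. -/
def TruncLatticeCount (t : ℕ) : Prop :=
  ∀ L : ℕ, ∀ δ : Fin t → ℝ, (∀ i, 0 < δ i) → (∑ i, δ i) ≤ 1 / 4 →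
    ∀ ε : ℝ, 0 < ε → ∃ N₀ : ℕ, ∀ N : ℕ, N₀ ≤ N → ∀ Ψ : Fin t → AffLinForm 1,
      IsNondegenerateSystem Ψ → affLinSize Ψ N ≤ L →
      ∀ K : Set (Fin 1 → ℝ), Convex ℝ K → K ⊆ realBox 1 N →
        |truncCorrSum Ψ K N (fun i => (N : ℝ) ^ (δ i)) -
            archFactor Ψ K * truncSingularSeries Ψ (fun i => (N : ℝ) ^ (δ i))| ≤ ε * N

/-- **T1b — the truncated singular series is asymptotic to the singular series**, uniformly: for
staggered levels `R_i = N^{δ_i}` (`δ_i > 0`, `2∑_{j>i} δ_j ≤ δ_i`, `∑ δ_i ≤ 1/4`) and every `ε > 0`,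
`|𝔖_R(Ψ) − 𝔖(Ψ)| ≤ ε (𝔖(Ψ) + 1)` for `N ≥ N₀(t, L, δ, ε)` and every non-degenerate `Ψ` with `‖Ψ‖_N ≤ L`.
Content (multivariate Goldston–Yıldırım I, Lemma 2.1 / Thm 1.1 along an affine system): `ρ_Ψ` is
multiplicative over the primes with local data `c_p(S) = #{n mod p : p ∣ ψ_i(n) ∀ i ∈ S} ∈ {0, 1, p}`;
sum the variables innermost-largest-level-first; each one-variable sum is
`∑_{d ≤ R, (d,M)=1} μ(d) h(d)/d · log(R/d) = ∏_{p∤M} (1 − h(p)/p)(1 − 1/p)⁻¹ · M/φ(M) + O(τ · e^{−c√log R})`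
for twists `h(p) = 1 + O(1/p)` (from the tree's PROVED `goldstonYildirim_lemma21_log_j0_holds` by
`h = 1 ⋆ f` on square-frees), the no-decay resonant primes (`p ∣ d_j` for a later variable `j` with
`p ∣ a_i b_j − a_j b_i`) removed by inclusion–exclusion — the staggering keeps their product `≤ R_i^{1/2}`;
the iterated Euler products multiply out prime by prime to `β_p = (1 − 1/p)^{-t} ∑_S (−1)^{|S|} c_p(S)/p^{[S≠∅]}`
(`localFactor`), and `∏_p β_p = singularProduct Ψ` by the tree's `tendsto_singularProductPartial_holds`;
uniformity from `𝔖(Ψ) ≪_t (log log N)^{t}` and `∑_{d ≤ R} τ(d)/d ≪ log² R`. Parity-blind. -/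
def TruncSingularSeriesAsymp (t : ℕ) : Prop :=
  ∀ L : ℕ, ∀ δ : Fin t → ℝ, (∀ i, 0 < δ i) → StaggeredBy 2 δ → (∑ i, δ i) ≤ 1 / 4 →
    ∀ ε : ℝ, 0 < ε → ∃ N₀ : ℕ, ∀ N : ℕ, N₀ ≤ N → ∀ Ψ : Fin t → AffLinForm 1,
      IsNondegenerateSystem Ψ → affLinSize Ψ N ≤ L →
        |truncSingularSeries Ψ (fun i => (N : ℝ) ^ (δ i)) - singularProduct Ψ| ≤
          ε * (singularProduct Ψ + 1)

/-- **T1 — the all-truncated sum carries the whole Hardy–Littlewood main term.** For staggered levels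
`R_i = N^{δ_i}` (`δ_i > 0`, `2∑_{j>i}δ_j ≤ δ_i`, `∑ δ_i ≤ 1/4`): uniformly over non-degenerate `d = 1`
systems of `t` forms with `‖Ψ‖_N ≤ L` and convex `K ⊆ [-N, N]`,
`|∑_{n ∈ K∩ℤ} ∏_i Λ_{R_i}(ψ_i(n)) − β_∞ 𝔖(Ψ)| ≤ ε (β_∞𝔖 + N)` for `N ≥ N₀(t, L, δ, ε)`. It is T1a + T1b
(`truncatedMainTerm_of`, proved in the skeleton, using `β_∞ ≤ 2N`). Parity-blind. -/
def TruncatedMainTerm (t : ℕ) : Prop :=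
  ∀ L : ℕ, ∀ δ : Fin t → ℝ, (∀ i, 0 < δ i) → StaggeredBy 2 δ → (∑ i, δ i) ≤ 1 / 4 →
    ∀ ε : ℝ, 0 < ε → ∃ N₀ : ℕ, ∀ N : ℕ, N₀ ≤ N → ∀ Ψ : Fin t → AffLinForm 1,
      IsNondegenerateSystem Ψ → affLinSize Ψ N ≤ L →
      ∀ K : Set (Fin 1 → ℝ), Convex ℝ K → K ⊆ realBox 1 N →
        |truncCorrSum Ψ K N (fun i => (N : ℝ) ^ (δ i)) - archFactor Ψ K * singularProduct Ψ| ≤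
          ε * (archFactor Ψ K * singularProduct Ψ + N)

/-- **T0' — the pure-Möbius term is negligible (Bombieri–Vinogradov for `μ`).** For level vectors with
`δ_i > 0`, `2 ∑_{i ≥ 1} δ_i < δ_0` and `∑_i δ_i ≤ 1/4`: uniformly over non-degenerate systems of `k + 1`
forms with `‖Ψ‖_N ≤ L` and convex `K ⊆ [-N, N]`,
`|∑_{n ∈ K∩ℤ} (Λ − Λ_{R_0})(ψ₀(n)) ∏_{i≥1} Λ_{R_i}(ψ_i(n))| ≤ ε N` for `N ≥ N₀(k, L, δ, ε)`.
Content: `(Λ − Λ_R)(m) = −∑_{d ∣ m, d > R} μ(d) log(d/R)` (`m ≥ 2`); expand the truncated factors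
(moduli `q ≤ ∏_{i≥1} R_i`), write `ψ₀(n) = d e`; for each `e ≤ 2LN/R_0` the `d`-sums are Möbius sums in
progressions of modulus `≤ L q` and length `≍ N/e ≥ N^{δ_0}/(2L)`, and
`L ∏_{i≥1} R_i ≤ (N/e)^{1/2} (log)^{-B}` by the staggering, so the tree's PROVED
`Literature.NumberTheory.Sieve.bombieriVinogradov_moebius`, with divisor-weight multiplicities
(Cauchy–Schwarz against the trivial bound), non-reduced classes (pull out the gcd) and the coprime means
(Siegel–Walfisz for `μ`), and partial summation of `log(d/R_0)`, gives `≪ N (log N)^{O(k)−A'}`. -/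
def MoebiusTermBound (k : ℕ) : Prop :=
  ∀ L : ℕ, ∀ δ : Fin (k + 1) → ℝ, (∀ i, 0 < δ i) → 2 * (∑ i : Fin k, δ i.succ) < δ 0 →
    (∑ i, δ i) ≤ 1 / 4 →
    ∀ ε : ℝ, 0 < ε → ∃ N₀ : ℕ, ∀ N : ℕ, N₀ ≤ N → ∀ Ψ : Fin (k + 1) → AffLinForm 1,
      IsNondegenerateSystem Ψ → affLinSize Ψ N ≤ L →
      ∀ K : Set (Fin 1 → ℝ), Convex ℝ K → K ⊆ realBox 1 N →
        |moebiusTermSum Ψ K N (fun i => (N : ℝ) ^ (δ i))| ≤ ε * N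

/-- **H_s — the single-Möbius hybrid Hardy–Littlewood–Chowla atom** (`s` prime forms, Möbius dilation
exponent `η`, prime dilation exponent `C`, log-power saving `A`). For a non-degenerate system
`Φ = (φ₀; φ₁, …, φ_s)` of `d = 1` forms with `|φ̇₀| ≤ L Y^η` (the MÖBIUS form: a progression whose modulus
is at most a small power of its length), `∑_{i≥1} |φ̇_i| ≤ L Y^C` (the PRIME forms, polynomially dilated)
and every shift at most `L` scales of its own form, `|φ_i(0)| ≤ L |φ̇_i| Y` (no short-interval content),
and any convex `K ⊆ [-Y, Y]`:
`|∑_{n ∈ K∩ℤ} μ(φ₀(n)) ∏_{i≥1} Λ(φ_i(n))| ≤ (β_∞(φ₁..φ_s; K) 𝔖(φ₁..φ_s) + Y) / (log Y)^A`, `Y ≥ Y₀(s,η,C,A,L)`.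
(`μ ∘ Int.toNat`: non-positive values of `φ₀` contribute `μ(0) = 0`.) For `s = 1`, `φ₀ = n`,
`φ₁ = g n + h`: "Möbius is orthogonal to the (dilated) shifted primes with a log-power saving"
(`Literature.NumberTheory.Sieve.MoebiusShiftedPrimesConjecture` is its `g = 1`, `o(1)` shadow); in print:
Lichtman–Teräväinen 2022 Thm 1.2 (average over the Möbius shift), Tao–Teräväinen 2021 (Siegel scales),
Sawin–Shusterman (over `𝔽_q[T]`, with dilations). OPEN for every `s ≥ 1` even at bounded dilation and even
on GRH. -/
def HybridOneMoebius (s : ℕ) (η C A : ℝ) : Prop :=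
  ∀ L : ℕ, ∃ Y₀ : ℕ, ∀ Y : ℕ, Y₀ ≤ Y → ∀ Φ : Fin (s + 1) → AffLinForm 1,
    IsNondegenerateSystem Φ →
    |(((Φ 0).coeff 0 : ℤ) : ℝ)| ≤ L * (Y : ℝ) ^ η →
    (∑ i : Fin s, |(((Φ i.succ).coeff 0 : ℤ) : ℝ)|) ≤ L * (Y : ℝ) ^ C →
    (∀ i, |(((Φ i).const : ℤ) : ℝ)| ≤ L * |(((Φ i).coeff 0 : ℤ) : ℝ)| * Y) →
    ∀ K : Set (Fin 1 → ℝ), Convex ℝ K → K ⊆ realBox 1 Y →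
      |∑ n ∈ (latticeBox 1 Y).filter (fun n => realPoint n ∈ K),
          (ArithmeticFunction.moebius ((Φ 0).eval n).toNat : ℝ) *
            ∏ i : Fin s, intVonMangoldt ((Φ i.succ).eval n)| ≤
        (archFactor (fun i : Fin s => Φ i.succ) K * singularProduct (fun i : Fin s => Φ i.succ) + Y) /
          Real.log Y ^ A

/-- **S1 — term `j ≥ 1` is negligible given the atom `H_j` at Möbius-dilation exponent `η`.** For levels
`R_i = N^{δ_i}` with `δ_i > 0`, `(2 + 1/η) ∑_{i>j'} δ_i ≤ δ_{j'}` for every `j'`, `∑ δ_i ≤ 1/4`: uniformly over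
non-degenerate systems of `k + 1` forms with `‖Ψ‖_N ≤ L` and convex `K ⊆ [-N, N]`,
`|telescopeTermSum Ψ K N R j| ≤ ε N` for `N ≥ N₀`. (The statement `TermBound k j η` is the CONCLUSION;
the registered stub is `j ≠ 0 → 0 < η → (∀ C A, HybridOneMoebius j η C A) → TermBound k j η`.)
Content: `(Λ − Λ_{R_j})(m) = −∑_{d ∣ m, d > R_j} μ(d) log(d/R_j)` for `m ≥ 2` (`m = 1`: one point, weight
`log R_j`); expand the truncated factors `i > j` over tuples `(d_i ≤ R_i)_{i>j}`; write `ψ_j(n) = d e`,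
`d > R_j`, `e ≤ 2LN/R_j`; for fixed `e` and tuple, integrality of `n = (de − b_j)/a_j` and the
divisibilities `d_i ∣ ψ_i(n)` put `d` in `≤ L^{O(k)}` classes `d = Q d' + r` modulo some
`Q ≤ L ∏_{i>j} R_i = L N^{∑_{i>j}δ_i}`; in the variable `d'` (an interval `⊆ [0, Y_e]`,
`Y_e ≍ 2LN/(eQ) ≥ N^{δ_j − ∑_{i>j}δ_i}/L`) the Möbius form `φ₀ = Q d' + r` has `|φ̇₀| = Q ≤ 2L² Y_e^η` by the
staggering, the prime forms `φ_i(d') = ψ_i(n(d'))`, `i < j`, have coefficients `≍ eQ ≤ Y_e^{C(δ)}` and shifts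
`≤ 2L² |φ̇_i| Y_e`, and `(φ₀; φ_i)_{i<j}` is non-degenerate because `Ψ` is; Abel summation of `log(d/R_j)`,
the atom on every initial segment, `β_∞(Φ') ≤ 2Y_e`, `𝔖(Φ') ≪ (log log N)^{j}`, and the sums over classes,
tuples (`∑ ∏ log(R_i/d_i)/Q ≪ (log N)^{2(k−j)}`) and `e` (`∑_e Y_e ≪ N log N / Q`) give
`≪ N (log N)^{2k+3}(log log N)^{O(k)} / (c(δ) log N)^A ≤ εN` for `A` large. -/
def TermBound (k : ℕ) (j : Fin (k + 1)) (η : ℝ) : Prop :=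
  ∀ L : ℕ, ∀ δ : Fin (k + 1) → ℝ, (∀ i, 0 < δ i) → StaggeredBy (2 + 1 / η) δ → (∑ i, δ i) ≤ 1 / 4 →
    ∀ ε : ℝ, 0 < ε → ∃ N₀ : ℕ, ∀ N : ℕ, N₀ ≤ N → ∀ Ψ : Fin (k + 1) → AffLinForm 1,
      IsNondegenerateSystem Ψ → affLinSize Ψ N ≤ L →
      ∀ K : Set (Fin 1 → ℝ), Convex ℝ K → K ⊆ realBox 1 N →
        |telescopeTermSum Ψ K N (fun i => (N : ℝ) ^ (δ i)) j| ≤ ε * N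

/-! ## Sanity lemmas (real proofs): the vocabulary computes as intended -/

/-- `Λ_R` vanishes on non-positive arguments (so the truncated sums see only the positivity region). -/
theorem lambdaR_nonpos (R : ℝ) {m : ℤ} (hm : m ≤ 0) : lambdaR R m = 0 := by
  unfold lambdaR
  have : m.toNat = 0 := Int.toNat_eq_zero.mpr hm
  simp [this]

/-- `β_∞ 𝔖 ≥ 0` for a non-degenerate system (limit of products of non-negative local factors,
Green–Tao Lemma 1.3 = tree `tendsto_singularProductPartial_holds`). -/
theorem mass_nonneg {t : ℕ} {Ψ : Fin t → AffLinForm 1} (hΨ : IsNondegenerateSystem Ψ)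
    (K : Set (Fin 1 → ℝ)) : 0 ≤ archFactor Ψ K * singularProduct Ψ :=
  mul_nonneg ENNReal.toReal_nonneg
    (ge_of_tendsto' (tendsto_singularProductPartial_holds 1 t Ψ hΨ) fun _ =>
      Finset.prod_nonneg fun p _ => localFactor_nonneg Ψ p)

/-- `𝔖 ≥ 0` for a non-degenerate system. -/
theorem singularProduct_nonneg' {t : ℕ} {Ψ : Fin t → AffLinForm 1} (hΨ : IsNondegenerateSystem Ψ) :
    0 ≤ singularProduct Ψ :=
  ge_of_tendsto' (tendsto_singularProductPartial_holds 1 t Ψ hΨ) fun _ =>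
    Finset.prod_nonneg fun p _ => localFactor_nonneg Ψ p

/-- The crux is literally `∀ k, RelDimOneSlice (k+1)` read backwards: each slice is a consequence. -/
theorem slice_of_relativeDimOne : RelativeDimOne → ∀ k : ℕ, RelDimOneSlice (k + 1) :=
  fun h k L ε hε => h (k + 1) L (Nat.succ_le_succ (Nat.zero_le k)) ε hε

/-- Staggering is monotone in the ratio: a larger ratio is a stronger condition (for `δ ≥ 0`). -/
theorem staggeredBy_mono {t : ℕ} {c c' : ℝ} {δ : Fin t → ℝ} (hδ : ∀ i, 0 ≤ δ i) (hcc' : c ≤ c')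
    (h : StaggeredBy c' δ) : StaggeredBy c δ := fun i =>
  (mul_le_mul_of_nonneg_right hcc' (Finset.sum_nonneg fun j _ => hδ j)).trans (h i)

/-- The atom is monotone in the Möbius-dilation exponent: a smaller `η` covers fewer systems
(`Y^{η'} ≤ Y^η` for `Y ≥ 1`; at `Y = 0` the hypothesis `0 ≤ Y₀ ≤ Y` is met by taking `Y₀ ≥ 1`). -/
theorem hybridOneMoebius_mono {s : ℕ} {η η' C A : ℝ} (hη : η' ≤ η) (h : HybridOneMoebius s η C A) :
    HybridOneMoebius s η' C A := by
  intro L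
  obtain ⟨Y₀, hY₀⟩ := h L
  refine ⟨max Y₀ 1, fun Y hY Φ hΦ h0 h1 h2 K hK hKY => ?_⟩
  have hY1 : (1 : ℝ) ≤ (Y : ℝ) := by exact_mod_cast le_of_max_le_right hY
  refine hY₀ Y (le_of_max_le_left hY) Φ hΦ (h0.trans ?_) h1 h2 K hK hKY
  exact mul_le_mul_of_nonneg_left (Real.rpow_le_rpow_of_exponent_le hY1 hη) (Nat.cast_nonneg L)

end Summit.Parity.GeneralizedHardyLittlewood.Cruxes.RelativeDimOne.SingleMoebiusSplit
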